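import Literature.Computability.Complexity.FoldBricks
import Literature.Computability.Complexity.NegCNFTranscoder
import HarnessLib

/-!
# Canonical re-encoding of the tree's Boolean codes is polynomial time (brick assembly)

Trunk toolkit for membership proofs in `#P` / `NP` over the tree's codes
(`Literature.Computability.Complexity.boolPair`, `Computability.Encoding.pairBool`,
`Computability.Encoding.listBool`, `encodingIntBool`, Mathlib's `encodingNatBool`,
`encodingBoolBool`). A counting function defined through `decode` (such as
`Literature.Barriers.CriticalPhenomena.GridSAW.SAWCOUNT₁`, Liśkiewicz–Ogihara–Toda 2003,
Theorem 7) takes the same value on every string decoding to the same object, while a witness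
relation can only recognise ONE code per object; the bridge is the **canonicalisation**
`w ↦ encode (decode w)` (`…GridSAW.canon₁`), which must be shown polynomial-time
(`Literature.Computability.Complexity.comp_mem_SharpP`). All decoders of these codes are TOTAL
(`boolUnpair`, `decodeNat`, `decodeBool`, `unaryDecodeNat = length` never fail;
`NegCNF.decode_cnf` of `NegCNFTranscoder.lean` is the CNF instance), so the canonicalisation is a
structural recursion over the shape of the code, and this file realises each constructor by the
tree's `FP` combinators — no machine is written:

* numerals: the tree's `Brick.canonF` (`FoldBricks.lean`: `canonF_eq_encodeNat_decodeNat`,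
  `canonF_mem_FP`, `length_canonF_le` — append a final `1` to a non-empty numeral ending in `0`)
  is used as is;
* bits: the tree's `HashBricks.headBitFn` is `encodeBool ∘ decodeBool`
  (`headBitFn_eq_encodeBool_decodeBool`);
* integers (`encodingIntBool`: sign bit, binary magnitude): `canonIntFn` = `⟨[sign ∧ magnitude
  ≠ 0], canonical magnitude⟩` (`canonIntFn_eq`: it is `encode ∘ decInt` for the total decoder
  `decInt`, `decode_int`); `|canonIntFn w| ≤ |w| + 5`;
* pairs: `canonPairFn ca cb = ⟨ca ∘ fst, cb ∘ snd⟩` (`fanoutFn`); `canonPairFn_eq` (it is the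
  re-encoding of `ea.pairBool eb` when `ca`, `cb` are those of `ea`, `eb`);
  `length_canonPairFn_le` (additive bounds add);
* lists: `canonListFn ci` — unary header of the same length (`onesFn`), then a counted loop
  (`Brick.loopFn_mem_FP`, records `⟨x, ⟨counter, ⟨rest, acc⟩⟩⟩`, body `listBody ci`: move one
  item from `rest` to `acc`, re-encoded by `ci` and re-paired) started from `listInit`
  (`⟨w, ⟨⌜n⌝, ⟨items, []⟩⟩⟩`, `n` = header length via `popCountFn ∘ onesFn`);
  `length_listBody_le` (an additively bounded `ci` makes each round lengthen the state by a
  constant — the item is doubled once in `rest` and once in `acc`), `loopModel_listBody`,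
  `canonListFn_apply`, and `canonListFn_eq`: for an encoding `e` with total decoder `d` and
  `ci = e.encode ∘ d`, `e.listBool.decode` is total (value `NegCNF.decList d n items`) and
  `canonListFn ci = encode ∘ decode`; `canonListFn_mem_FP` (for `ci ∈ FP` additively bounded).

Nested lists: `canonListFn` is only linearly bounded, so it cannot be the item map of another
`canonListFn`; the last section provides **`canonListFnC C ci`** — the same loop with the
canonicalised item CLIPPED to `C (|x| + 1)` symbols by `Brick.clipF` (`FoldBricks.lean`), which
makes the growth bound hold for every item map (`canonListFnC_mem_FP`, no size hypothesis) and is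
the identity on the intended runs (`canonListFnC_apply`/`canonListFnC_eq` for `|ci u| ≤ A|u| + B`,
`A + B ≤ C`); its own size is linear (`length_canonListFnC_le`), so lists nest to any depth (used
for codes of grid drawings: lists of edges carrying lists of points).

Design notes. (1) `canonListFn` is a header-COUNTED loop and deliberately not the list fold
`Brick.foldFn` of `ListFoldBricks.lean`: `encode ∘ decode` must follow the tree's
`listBoolDecode` (`BoolEncodings.lean`, fuel = Mathlib's `unaryDecodeNat` = length), which reads exactly `n = |header|` items off the body (reading `ε` items past
its end and ignoring any excess), whereas `foldFn` parses the body with `Brick.decNil` until the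
string is exhausted; the two agree on genuine codes only. The items part produced is the framed
code `frames` of `EncodingFrames.lean` (`itemsCanon_eq_frames`). (2) `NegCNFTranscoder.lean` (a
machine file) is imported only for the four generic decoding lemmas `NegCNF.decList`,
`NegCNF.length_decList`, `NegCNF.listBoolDecode_eq`, `NegCNF.unaryDecodeNat_eq_length`; a
librarian hoist of those next to `listBoolDecode` (`BoolEncodings.lean`) would remove that import.

## References

* S. Arora, B. Barak, *Computational Complexity: A Modern Approach*, CUP 2009, §0.1
  (representations; pairs and tuples of strings), §1.3 (polynomial time is closed under
  composition and bounded loops), Def. 17.2 (`#P` by witness counting).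
-/

namespace Literature.Computability.Complexity

open _root_.Computability Brick

namespace CanonCode

/-! ### Bits: `encodeBool ∘ decodeBool` is the tree's `headBitFn` -/

/-- The canonicalisation of bit codes `u ↦ encodeBool (decodeBool u)` is the existing brick
`HashBricks.headBitFn` (`headBitFn w = [w.headD false]`; Mathlib's `decodeBool` is the head
with default `false`). [folklore] -/
theorem headBitFn_eq_encodeBool_decodeBool (u : List Bool) :
    HashBricks.headBitFn u = encodeBool (decodeBool u) := by
  rw [HashBricks.headBitFn_apply]; cases u <;> rfl

/-! ### Pairs -/

/-- **Canonicalisation of pair codes** from canonicalisations of the components: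
`w ↦ ⟨ca (boolUnpair w).1, cb (boolUnpair w).2⟩`. [folklore] -/
noncomputable def canonPairFn (ca cb : List Bool → List Bool) : List Bool → List Bool :=
  fanoutFn (ca ∘ fstF) (cb ∘ sndF)

/-- Value of `canonPairFn`. [folklore] -/
theorem canonPairFn_apply (ca cb : List Bool → List Bool) (w : List Bool) :
    canonPairFn ca cb w = boolPair (ca (boolUnpair w).1) (cb (boolUnpair w).2) := by
  simp [canonPairFn, fstF, sndF]

/-- `canonPairFn ca cb ∈ FP` for `ca, cb ∈ FP`. [folklore] -/
theorem canonPairFn_mem_FP {ca cb : List Bool → List Bool} (ha : ca ∈ FP) (hb : cb ∈ FP) :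
    canonPairFn ca cb ∈ FP :=
  fanoutFn_mem_FP (comp_mem_FP ha fstF_mem_FP) (comp_mem_FP hb sndF_mem_FP)

/-- **`canonPairFn` re-encodes**: if `ca`, `cb` are the re-encodings of total decoders `da`,
`db` of `ea`, `eb`, then `canonPairFn ca cb` is the re-encoding of the (total) decoder of
`ea.pairBool eb`. [folklore] -/
theorem canonPairFn_eq {α β : Type} (ea : Encoding α Bool) (eb : Encoding β Bool)
    (da : List Bool → α) (db : List Bool → β) (hda : ∀ u, ea.decode u = some (da u))
    (hdb : ∀ u, eb.decode u = some (db u)) {ca cb : List Bool → List Bool}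
    (hca : ∀ u, ca u = ea.encode (da u)) (hcb : ∀ u, cb u = eb.encode (db u)) (w : List Bool) :
    (ea.pairBool eb).decode w = some (da (boolUnpair w).1, db (boolUnpair w).2) ∧
      canonPairFn ca cb w = (ea.pairBool eb).encode (da (boolUnpair w).1, db (boolUnpair w).2) := by
  constructor
  · simp [Encoding.pairBool, hda, hdb]
  · rw [canonPairFn_apply, hca, hcb]; rfl

/-- Size of `canonPairFn`: additive constants add up (`2 |fst| + |snd| ≤ |w|`). [folklore] -/
theorem length_canonPairFn_le {ca cb : List Bool → List Bool} {a b : ℕ}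
    (ha : ∀ u, (ca u).length ≤ u.length + a) (hb : ∀ u, (cb u).length ≤ u.length + b)
    (w : List Bool) : (canonPairFn ca cb w).length ≤ w.length + (2 * a + b + 2) := by
  rw [canonPairFn_apply, length_boolPair]
  have h := length_boolUnpair_parts_le w
  have h1 := ha (boolUnpair w).1
  have h2 := hb (boolUnpair w).2
  omega

/-! ### Integers (sign bit, binary magnitude) -/

/-- The integer read off any string by `encodingIntBool.decode` (total): sign bit of the first
component (Mathlib's `decodeBool`: head with default `false`), `decodeNat` of the second. NOT the
same as `Brick.smval` (`IntPairBricks.lean`), which reads the same sign–magnitude format with the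
test `fst = [1]` and `bitsToNat`, and so differs on malformed components; `decInt` is the value of
the tree's decoder (`decode_int`). [folklore] -/
def decInt (w : List Bool) : ℤ :=
  if decodeBool (boolUnpair w).1 then -(decodeNat (boolUnpair w).2 : ℤ) else decodeNat (boolUnpair w).2

/-- `encodingIntBool.decode` is total with value `decInt`. [folklore] -/
theorem decode_int (w : List Bool) : encodingIntBool.decode w = some (decInt w) := by
  simp [encodingIntBool, Encoding.pairBool, encodingBoolBool, encodingNatBool, decInt]

/-- **Canonicalisation of integer codes**: `⟨[sign ∧ magnitude ≠ 0], canonical magnitude⟩`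
(`-0` is re-encoded as `0`). [folklore] -/
noncomputable def canonIntFn : List Bool → List Bool :=
  fanoutFn (andFn (HashBricks.headBitFn ∘ fstF) (notFn (isNilFn ∘ canonF ∘ sndF))) (canonF ∘ sndF)

/-- `canonIntFn ∈ FP`. [folklore] -/
theorem canonIntFn_mem_FP : canonIntFn ∈ FP :=
  fanoutFn_mem_FP
    (andFn_mem_FP (comp_mem_FP HashBricks.headBitFn_mem_FP fstF_mem_FP)
      (notFn_mem_FP (comp_mem_FP isNilFn_mem_FP (comp_mem_FP canonF_mem_FP sndF_mem_FP))))
    (comp_mem_FP canonF_mem_FP sndF_mem_FP)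

/-- Value of `canonIntFn`. [folklore] -/
theorem canonIntFn_apply (w : List Bool) :
    canonIntFn w = boolPair
      [decodeBool (boolUnpair w).1 && !decide (encodeNat (decodeNat (boolUnpair w).2) = [])]
      (encodeNat (decodeNat (boolUnpair w).2)) := by
  have hc : (HashBricks.headBitFn ∘ fstF) w = [decodeBool (boolUnpair w).1] := by
    rw [Function.comp_apply, headBitFn_eq_encodeBool_decodeBool]; rfl
  have hn : (isNilFn ∘ canonF ∘ sndF) w = [decide (encodeNat (decodeNat (boolUnpair w).2) = [])] := by
    simp [Function.comp_apply, isNilFn, canonF_eq_encodeNat_decodeNat, sndF]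
  rw [canonIntFn, fanoutFn_apply, andFn_apply hc (notFn_apply hn)]
  simp [Function.comp_apply, canonF_eq_encodeNat_decodeNat, sndF]

/-- `canonIntFn w = encodingIntBool.encode (decInt w)`. [folklore] -/
theorem canonIntFn_eq (w : List Bool) : canonIntFn w = encodingIntBool.encode (decInt w) := by
  -- the code of an integer, flat: sign bit then canonical magnitude (as in
  -- `Literature.Algebra.EuclideanLattices.GMSS.encodingIntBool_encode`, not imported here)
  rw [canonIntFn_apply, show encodingIntBool.encode (decInt w) =
    boolPair [decide (decInt w < 0)] (encodeNat (decInt w).natAbs) from rfl, decInt]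
  have key : ∀ n : ℕ, (encodeNat n = []) ↔ n = 0 := fun n =>
    ⟨fun h => by
      have h' := congrArg decodeNat h
      rw [decode_encodeNat] at h'
      rw [h']; decide, fun h => by subst h; rfl⟩
  set m := decodeNat (boolUnpair w).2 with hm
  cases decodeBool (boolUnpair w).1
  · have h0 : ¬ ((m : ℤ) < 0) := by omega
    simp [h0]
  · simp only [Bool.true_and, ite_true, Int.natAbs_neg, Int.natAbs_natCast, Left.neg_neg_iff]
    congr 2
    rw [Bool.eq_iff_iff]
    simp [key, Nat.pos_iff_ne_zero]

/-- `|canonIntFn w| ≤ |w| + 5`. [folklore] -/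
theorem length_canonIntFn_le (w : List Bool) : (canonIntFn w).length ≤ w.length + 5 := by
  rw [canonIntFn_apply, length_boolPair, ← canonF_eq_encodeNat_decodeNat]
  have h := length_boolUnpair_parts_le w
  have h2 := length_canonF_le (boolUnpair w).2
  simp only [List.length_singleton]
  omega

/-! ### Lists: re-encoding the items one by one in a counted loop -/

/-- The items of a list code canonicalised and re-assembled: for `k` items read off `r` by
`boolUnpair`, the concatenation of `dbl (ci item) ++ 01`. [folklore] -/
def itemsCanon (ci : List Bool → List Bool) : ℕ → List Bool → List Bool
  | 0, _ => []
  | k + 1, r => SProg.dbl (ci (boolUnpair r).1) ++ false :: true :: itemsCanon ci k (boolUnpair r).2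

/-- The re-assembled items are the framed code (`EncodingFrames.lean`) of the canonicalised
raw items `(boolUnpair r).1, (boolUnpair (boolUnpair r).2).1, …`. [folklore] -/
theorem itemsCanon_eq_frames (ci : List Bool → List Bool) :
    ∀ (k : ℕ) (r : List Bool), itemsCanon ci k r = frames ((NegCNF.decList id k r).map ci)
  | 0, _ => rfl
  | k + 1, r => by
    rw [itemsCanon, NegCNF.decList, List.map_cons, frames_cons_eq_boolPair, CookLevin.boolPair_eq_dbl,
      itemsCanon_eq_frames ci k]
    rfl

/-- The body of the list loop on records `⟨x, ⟨counter, ⟨rest, acc⟩⟩⟩`: move one canonicalised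
item from `rest` to `acc`. [folklore] -/
noncomputable def listBody (ci : List Bool → List Bool) : List Bool → List Bool :=
  fanoutFn (sndF ∘ nthF 2)
    (fun z => sndPow 2 z ++ (SProg.dbl (ci (fstF (nthF 2 z))) ++ [false, true]))

/-- `listBody ci ∈ FP` for `ci ∈ FP`. [folklore] -/
theorem listBody_mem_FP {ci : List Bool → List Bool} (h : ci ∈ FP) : listBody ci ∈ FP :=
  fanoutFn_mem_FP (comp_mem_FP sndF_mem_FP (nthF_mem_FP 2))
    (append_mem_FP (sndPow_mem_FP 2) (append_mem_FP
      (comp_mem_FP SProg.dbl_mem_FP (comp_mem_FP h (comp_mem_FP fstF_mem_FP (nthF_mem_FP 2))))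
      (const_mem_FP _)))

/-- Value of the body on a record. [folklore] -/
theorem listBody_apply (ci : List Bool → List Bool) (x c r acc : List Bool) :
    listBody ci (boolPair x (boolPair c (boolPair r acc))) =
      boolPair (boolUnpair r).2 (acc ++ (SProg.dbl (ci (boolUnpair r).1) ++ [false, true])) := by
  simp [listBody, nthF, sndPow, fstF, sndF]

/-- **Growth of the body**: with an additively bounded item canonicaliser, one round lengthens
the state by a constant (the item moves from `rest` to `acc`, doubled once in both places).
[folklore] -/
theorem length_listBody_le {ci : List Bool → List Bool} {a : ℕ}
    (ha : ∀ u, (ci u).length ≤ u.length + a) (z : List Bool) :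
    (listBody ci z).length ≤ (sndPow 1 z).length + (2 * a + 4) * ((fstF z).length + 1) := by
  have e2 : nthF 2 z = fstF (sndF (sndF z)) := rfl
  have e3 : sndPow 2 z = sndF (sndF (sndF z)) := rfl
  have e1 : sndPow 1 z = sndF (sndF z) := rfl
  have hst : 2 * (fstF (sndF (sndF z))).length + (sndF (sndF (sndF z))).length ≤
      (sndF (sndF z)).length := length_fstF_sndF_le _
  have hr : 2 * (fstF (fstF (sndF (sndF z)))).length + (sndF (fstF (sndF (sndF z)))).length ≤
      (fstF (sndF (sndF z))).length := length_fstF_sndF_le _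
  have hi := ha (fstF (fstF (sndF (sndF z))))
  have h1 : (listBody ci z).length =
      2 * (sndF (fstF (sndF (sndF z)))).length + 2 + ((sndF (sndF (sndF z))).length +
        (2 * (ci (fstF (fstF (sndF (sndF z))))).length + 2)) := by
    simp only [listBody, fanoutFn_apply, Function.comp_apply, length_boolPair, List.length_append,
      List.length_cons, List.length_nil, SProg.length_dbl, e2, e3]
  rw [h1, e1]
  nlinarith

/-- The model of the loop: `k` rounds move `k` canonicalised items. [folklore] -/
theorem loopModel_listBody (ci : List Bool → List Bool) (x : List Bool) :
    ∀ (k : ℕ) (r acc : List Bool), loopModel (listBody ci) x k (boolPair r acc) =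
      boolPair (sndF^[k] r) (acc ++ itemsCanon ci k r)
  | 0, r, acc => by simp [loopModel, itemsCanon]
  | k + 1, r, acc => by
    rw [loopModel, listBody_apply, loopModel_listBody ci x k]
    simp [itemsCanon, sndF, Function.iterate_succ_apply, List.append_assoc]

/-- The initial record of the list loop: `⟨w, ⟨⌜n⌝, ⟨items part, []⟩⟩⟩` with `n` the unary
header length. [folklore] -/
noncomputable def listInit : List Bool → List Bool :=
  fanoutFn id (fanoutFn (HashBricks.popCountFn ∘ onesFn ∘ fstF) (fanoutFn sndF fun _ => []))

/-- `listInit ∈ FP`. [folklore] -/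
theorem listInit_mem_FP : listInit ∈ FP :=
  fanoutFn_mem_FP OracleCompose.id_mem_FP (fanoutFn_mem_FP
    (comp_mem_FP HashBricks.popCountFn_mem_FP (comp_mem_FP onesFn_mem_FP fstF_mem_FP))
    (fanoutFn_mem_FP sndF_mem_FP (const_mem_FP _)))

/-- Value of `listInit`. [folklore] -/
theorem listInit_apply (w : List Bool) :
    listInit w = boolPair w (boolPair (encodeNat (boolUnpair w).1.length)
      (boolPair (boolUnpair w).2 [])) := by
  simp [listInit, fstF, sndF, onesFn, OracleCompose.unaryEncodeNat_eq_replicate, List.count_replicate_self]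

open Polynomial in
/-- The list loop: `|x|` rounds of `loopStep (listBody ci)` (enough for the `≤ |x| / 2` items).
[folklore] -/
noncomputable def listLoop (ci : List Bool → List Bool) : List Bool → List Bool := fun z =>
  (loopStep (listBody ci))^[(X : Polynomial ℕ).eval (fstF z).length] z

open Polynomial in
/-- `listLoop ci ∈ FP` for an additively bounded `ci ∈ FP`. [folklore] -/
theorem listLoop_mem_FP {ci : List Bool → List Bool} (hci : ci ∈ FP) {a : ℕ}
    (ha : ∀ u, (ci u).length ≤ u.length + a) : listLoop ci ∈ FP :=
  loopFn_mem_FP (listBody_mem_FP hci) (length_listBody_le ha) X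

/-- **Canonicalisation of list codes**: unary header of the same length, then the items
re-encoded one by one. [folklore] -/
noncomputable def canonListFn (ci : List Bool → List Bool) : List Bool → List Bool :=
  fanoutFn (onesFn ∘ fstF) (sndPow 2 ∘ listLoop ci ∘ listInit)

/-- `canonListFn ci ∈ FP` for an additively bounded `ci ∈ FP`. [folklore] -/
theorem canonListFn_mem_FP {ci : List Bool → List Bool} (hci : ci ∈ FP) {a : ℕ}
    (ha : ∀ u, (ci u).length ≤ u.length + a) : canonListFn ci ∈ FP :=
  fanoutFn_mem_FP (comp_mem_FP onesFn_mem_FP fstF_mem_FP)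
    (comp_mem_FP (sndPow_mem_FP 2) (comp_mem_FP (listLoop_mem_FP hci ha) listInit_mem_FP))

/-- **Value of `canonListFn`**: header `1ⁿ` for the `n` bits of the input's header, then the `n`
canonicalised items. [folklore] -/
theorem canonListFn_apply (ci : List Bool → List Bool) (w : List Bool) :
    canonListFn ci w = boolPair (unaryEncodeNat (boolUnpair w).1.length)
      (itemsCanon ci (boolUnpair w).1.length (boolUnpair w).2) := by
  have hn : (boolUnpair w).1.length ≤ w.length := by
    have := length_boolUnpair_parts_le w; omega
  have hloop : listLoop ci (listInit w) = boolPair w (boolPair []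
      (boolPair (sndF^[(boolUnpair w).1.length] (boolUnpair w).2)
        (itemsCanon ci (boolUnpair w).1.length (boolUnpair w).2))) := by
    rw [listLoop, listInit_apply, fstF_boolPair, Polynomial.eval_X, iterate_loopStep _ _ _ _ _ hn,
      loopModel_listBody, List.nil_append]
  rw [canonListFn, fanoutFn_apply, Function.comp_apply, Function.comp_apply, Function.comp_apply,
    hloop]
  simp [onesFn, fstF]

/-- The items of the total list decoding, folded back into a code, are `itemsCanon` of the item
re-encoding. [folklore] -/
theorem foldr_decList {α : Type} (e : Encoding α Bool) (d : List Bool → α)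
    {ci : List Bool → List Bool} (hci : ∀ u, ci u = e.encode (d u)) :
    ∀ (k : ℕ) (r : List Bool), (NegCNF.decList d k r).foldr (fun a acc => boolPair (e.encode a) acc) [] =
      itemsCanon ci k r
  | 0, _ => rfl
  | k + 1, r => by
    rw [NegCNF.decList, List.foldr_cons, foldr_decList e d hci k, itemsCanon, CookLevin.boolPair_eq_dbl,
      hci]

/-- **`canonListFn` re-encodes**: for an encoding `e` with total decoder `d` and the item
re-encoding `ci = e.encode ∘ d`, the list decoder of `e.listBool` is total and `canonListFn ci`
is its re-encoding `encode ∘ decode`. [folklore] -/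
theorem canonListFn_eq {α : Type} (e : Encoding α Bool) (d : List Bool → α)
    (hd : ∀ u, e.decode u = some (d u)) {ci : List Bool → List Bool}
    (hci : ∀ u, ci u = e.encode (d u)) (w : List Bool) :
    e.listBool.decode w = some (NegCNF.decList d (boolUnpair w).1.length (boolUnpair w).2) ∧
      canonListFn ci w =
        e.listBool.encode (NegCNF.decList d (boolUnpair w).1.length (boolUnpair w).2) := by
  constructor
  · simp only [Encoding.listBool, NegCNF.unaryDecodeNat_eq_length]
    exact NegCNF.listBoolDecode_eq e d hd _ _
  · rw [canonListFn_apply]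
    simp only [Encoding.listBool, NegCNF.length_decList, foldr_decList e d hci]

/-! ### Nested lists: linearly bounded item canonicalisers, by clipping -/

/-- Size of `itemsCanon` for a linearly bounded item map: `A |r| + k (2B + 2)`. [folklore] -/
theorem length_itemsCanon_le {ci : List Bool → List Bool} {A B : ℕ} (hci : ∀ u, (ci u).length ≤ A * u.length + B) :
    ∀ (k : ℕ) (r : List Bool), (itemsCanon ci k r).length ≤ A * r.length + k * (2 * B + 2)
  | 0, r => by simp [itemsCanon]
  | k + 1, r => by
    have h1 := hci (boolUnpair r).1
    have h2 := length_itemsCanon_le hci k (boolUnpair r).2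
    have h3 := length_boolUnpair_parts_le r
    simp only [itemsCanon, List.length_append, SProg.length_dbl, List.length_cons]
    nlinarith

/-- **Linear size of a canonicalised list**: for `|ci u| ≤ A |u| + B`,
`|⟨1ⁿ, itemsCanon ci n items⟩| ≤ (A + B + 2) |w| + 2`. [folklore] -/
theorem length_listCanon_le {ci : List Bool → List Bool} {A B : ℕ} (hci : ∀ u, (ci u).length ≤ A * u.length + B)
    (w : List Bool) :
    (boolPair (unaryEncodeNat (boolUnpair w).1.length) (itemsCanon ci (boolUnpair w).1.length (boolUnpair w).2)).length ≤
      (A + B + 2) * w.length + 2 := by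
  have h1 := length_itemsCanon_le hci (boolUnpair w).1.length (boolUnpair w).2
  have h2 := length_boolUnpair_parts_le w
  rw [length_boolPair, OracleCompose.unaryEncodeNat_eq_replicate, List.length_replicate]
  nlinarith

/-- Linear bounds pass through `canonPairFn`. [folklore] -/
theorem length_canonPairFn_le_linear {ca cb : List Bool → List Bool} {A B A' B' : ℕ}
    (ha : ∀ u, (ca u).length ≤ A * u.length + B) (hb : ∀ u, (cb u).length ≤ A' * u.length + B') (w : List Bool) :
    (canonPairFn ca cb w).length ≤ (A + A') * w.length + (2 * B + B' + 2) := by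
  rw [canonPairFn_apply, length_boolPair]
  have h := length_boolUnpair_parts_le w
  have h1 := ha (boolUnpair w).1
  have h2 := hb (boolUnpair w).2
  nlinarith

/-- **The clipped list body**: as `listBody`, but the canonicalised item is clipped to
`C (|x| + 1)` symbols (`Brick.clipF`, with `x` the preserved first field = the input); this makes
the growth bound of `loopFn_mem_FP` hold for EVERY item map, and changes nothing on the intended
runs, where items are parts of `x`. [folklore] -/
noncomputable def listBodyClip (C : ℕ) (ci : List Bool → List Bool) : List Bool → List Bool :=
  fanoutFn (sndF ∘ nthF 2)
    (appF ∘ fanoutFn (sndPow 2) (appF ∘ fanoutFn (SProg.dbl ∘ clipF C (ci ∘ fstF ∘ nthF 2)) fun _ => [false, true]))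

/-- `listBodyClip C ci ∈ FP` for `ci ∈ FP`. [folklore] -/
theorem listBodyClip_mem_FP (C : ℕ) {ci : List Bool → List Bool} (h : ci ∈ FP) : listBodyClip C ci ∈ FP :=
  fanoutFn_mem_FP (comp_mem_FP sndF_mem_FP (nthF_mem_FP 2))
    (comp_mem_FP appF_mem_FP (fanoutFn_mem_FP (sndPow_mem_FP 2) (comp_mem_FP appF_mem_FP
      (fanoutFn_mem_FP (comp_mem_FP SProg.dbl_mem_FP
        (clipF_mem_FP C (comp_mem_FP h (comp_mem_FP fstF_mem_FP (nthF_mem_FP 2))))) (const_mem_FP _)))))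

/-- Value of the clipped body, as a formula. [folklore] -/
theorem listBodyClip_apply' (C : ℕ) (ci : List Bool → List Bool) (z : List Bool) :
    listBodyClip C ci z = boolPair (sndF (nthF 2 z)) (sndPow 2 z ++ (SProg.dbl (clipF C (ci ∘ fstF ∘ nthF 2) z) ++ [false, true])) := by
  simp [listBodyClip, appF]

/-- **Growth of the clipped body**, unconditionally. [folklore] -/
theorem length_listBodyClip_le (C : ℕ) (ci : List Bool → List Bool) (z : List Bool) :
    (listBodyClip C ci z).length ≤ (sndPow 1 z).length + (2 * C + 4) * ((fstF z).length + 1) := by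
  have e2 : nthF 2 z = fstF (sndF (sndF z)) := rfl
  have e3 : sndPow 2 z = sndF (sndF (sndF z)) := rfl
  have e1 : sndPow 1 z = sndF (sndF z) := rfl
  have hst : 2 * (fstF (sndF (sndF z))).length + (sndF (sndF (sndF z))).length ≤ (sndF (sndF z)).length :=
    length_fstF_sndF_le _
  have hr : 2 * (fstF (fstF (sndF (sndF z)))).length + (sndF (fstF (sndF (sndF z)))).length ≤
      (fstF (sndF (sndF z))).length := length_fstF_sndF_le _
  have hclip := length_clipF_le C (ci ∘ fstF ∘ nthF 2) z
  have h1 : (listBodyClip C ci z).length = 2 * (sndF (fstF (sndF (sndF z)))).length + 2 +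
      ((sndF (sndF (sndF z))).length + (2 * (clipF C (ci ∘ fstF ∘ nthF 2) z).length + 2)) := by
    simp only [listBodyClip_apply', length_boolPair, List.length_append,
      List.length_cons, List.length_nil, SProg.length_dbl, e2, e3]
  rw [h1, e1]
  nlinarith

/-- Value of the clipped body on a record whose item is short: the same as `listBody`. [folklore] -/
theorem listBodyClip_apply {C : ℕ} (ci : List Bool → List Bool) (x c r acc : List Bool)
    (h : (ci (boolUnpair r).1).length ≤ C * (x.length + 1)) :
    listBodyClip C ci (boolPair x (boolPair c (boolPair r acc))) =
      boolPair (boolUnpair r).2 (acc ++ (SProg.dbl (ci (boolUnpair r).1) ++ [false, true])) := by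
  have hc : clipF C (ci ∘ fstF ∘ nthF 2) (boolPair x (boolPair c (boolPair r acc))) = ci (boolUnpair r).1 := by
    rw [clipF_eq_self] <;> simp [nthF, fstF, h]
  rw [listBodyClip_apply', hc]
  simp [nthF, sndPow, fstF, sndF]

/-- The items read off `r` are no longer than `r`. [folklore] -/
theorem length_item_le (r : List Bool) (i : ℕ) : (boolUnpair (sndF^[i] r)).1.length ≤ r.length := by
  induction i generalizing r with
  | zero => have := length_boolUnpair_parts_le r; simp; omega
  | succ i ih =>
    rw [Function.iterate_succ_apply]
    have h1 := ih (sndF r)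
    have h2 := length_boolUnpair_parts_le r
    simp only [sndF] at h1 ⊢
    omega

/-- The model of the clipped loop, for short items: `k` rounds move `k` canonicalised items.
[folklore] -/
theorem loopModel_listBodyClip {C : ℕ} (ci : List Bool → List Bool) (x : List Bool) :
    ∀ (k : ℕ) (r acc : List Bool), (∀ i < k, (ci (boolUnpair (sndF^[i] r)).1).length ≤ C * (x.length + 1)) →
      loopModel (listBodyClip C ci) x k (boolPair r acc) = boolPair (sndF^[k] r) (acc ++ itemsCanon ci k r)
  | 0, r, acc, _ => by simp [loopModel, itemsCanon]
  | k + 1, r, acc, h => by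
    rw [loopModel, listBodyClip_apply ci x _ r acc (by simpa using h 0 (Nat.succ_pos k)),
      loopModel_listBodyClip ci x k _ _ (fun i hi => by
        have := h (i + 1) (by omega); rwa [Function.iterate_succ_apply] at this)]
    simp [itemsCanon, sndF, Function.iterate_succ_apply, List.append_assoc]

open Polynomial in
/-- The clipped list loop. [folklore] -/
noncomputable def listLoopClip (C : ℕ) (ci : List Bool → List Bool) : List Bool → List Bool := fun z =>
  (loopStep (listBodyClip C ci))^[(X : Polynomial ℕ).eval (fstF z).length] z

open Polynomial in
/-- `listLoopClip C ci ∈ FP` for every `ci ∈ FP`. [folklore] -/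
theorem listLoopClip_mem_FP (C : ℕ) {ci : List Bool → List Bool} (hci : ci ∈ FP) : listLoopClip C ci ∈ FP :=
  loopFn_mem_FP (listBodyClip_mem_FP C hci) (length_listBodyClip_le C ci) X

/-- **Canonicalisation of list codes with a linearly bounded item canonicaliser** (nested
lists): `canonListFnC C ci`, the clipped loop. [folklore] -/
noncomputable def canonListFnC (C : ℕ) (ci : List Bool → List Bool) : List Bool → List Bool :=
  fanoutFn (onesFn ∘ fstF) (sndPow 2 ∘ listLoopClip C ci ∘ listInit)

/-- `canonListFnC C ci ∈ FP` for every `ci ∈ FP`. [folklore] -/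
theorem canonListFnC_mem_FP (C : ℕ) {ci : List Bool → List Bool} (hci : ci ∈ FP) : canonListFnC C ci ∈ FP :=
  fanoutFn_mem_FP (comp_mem_FP onesFn_mem_FP fstF_mem_FP)
    (comp_mem_FP (sndPow_mem_FP 2) (comp_mem_FP (listLoopClip_mem_FP C hci) listInit_mem_FP))

/-- **Value of `canonListFnC`** when the clip is wide enough for the item map
(`|ci u| ≤ A |u| + B`, `A + B ≤ C`): the same as `canonListFn`. [folklore] -/
theorem canonListFnC_apply {C A B : ℕ} {ci : List Bool → List Bool} (hci : ∀ u, (ci u).length ≤ A * u.length + B)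
    (hC : A + B ≤ C) (w : List Bool) :
    canonListFnC C ci w = boolPair (unaryEncodeNat (boolUnpair w).1.length)
      (itemsCanon ci (boolUnpair w).1.length (boolUnpair w).2) := by
  have hn : (boolUnpair w).1.length ≤ w.length := by
    have := length_boolUnpair_parts_le w; omega
  have hshort : ∀ i < (boolUnpair w).1.length,
      (ci (boolUnpair (sndF^[i] (boolUnpair w).2)).1).length ≤ C * (w.length + 1) := by
    intro i _
    have h1 := hci (boolUnpair (sndF^[i] (boolUnpair w).2)).1
    have h2 := length_item_le (boolUnpair w).2 i
    have h3 : (boolUnpair w).2.length ≤ w.length := by have := length_boolUnpair_parts_le w; omega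
    nlinarith
  have hloop : listLoopClip C ci (listInit w) = boolPair w (boolPair []
      (boolPair (sndF^[(boolUnpair w).1.length] (boolUnpair w).2)
        (itemsCanon ci (boolUnpair w).1.length (boolUnpair w).2))) := by
    rw [listLoopClip, listInit_apply, fstF_boolPair, Polynomial.eval_X, iterate_loopStep _ _ _ _ _ hn,
      loopModel_listBodyClip ci w _ _ _ hshort, List.nil_append]
  rw [canonListFnC, fanoutFn_apply, Function.comp_apply, Function.comp_apply, Function.comp_apply, hloop]
  simp [onesFn, fstF]

/-- **`canonListFnC` re-encodes** (as `canonListFn_eq`, without the additive-bound restriction).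
[folklore] -/
theorem canonListFnC_eq {α : Type} (e : Encoding α Bool) (d : List Bool → α)
    (hd : ∀ u, e.decode u = some (d u)) {ci : List Bool → List Bool} (hcieq : ∀ u, ci u = e.encode (d u))
    {C A B : ℕ} (hci : ∀ u, (ci u).length ≤ A * u.length + B) (hC : A + B ≤ C) (w : List Bool) :
    e.listBool.decode w = some (NegCNF.decList d (boolUnpair w).1.length (boolUnpair w).2) ∧
      canonListFnC C ci w = e.listBool.encode (NegCNF.decList d (boolUnpair w).1.length (boolUnpair w).2) := by
  constructor
  · simp only [Encoding.listBool, NegCNF.unaryDecodeNat_eq_length]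
    exact NegCNF.listBoolDecode_eq e d hd _ _
  · rw [canonListFnC_apply hci hC]
    simp only [Encoding.listBool, NegCNF.length_decList, foldr_decList e d hcieq]

/-- **Linear size of `canonListFnC`**: `(A + B + 2) |w| + 2`, so it can itself serve as an item
canonicaliser one level up. [folklore] -/
theorem length_canonListFnC_le {C A B : ℕ} {ci : List Bool → List Bool} (hci : ∀ u, (ci u).length ≤ A * u.length + B)
    (hC : A + B ≤ C) (w : List Bool) : (canonListFnC C ci w).length ≤ (A + B + 2) * w.length + 2 := by
  rw [canonListFnC_apply hci hC]; exact length_listCanon_le hci w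

end CanonCode

end Literature.Computability.Complexity
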